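import Literature.IUT.LogVolume.PacketDifferentSharp
import Literature.IUT.LogVolume.LocalFieldEmbeddings
import Mathlib.FieldTheory.Galois.Basic
import Mathlib.RingTheory.Trace.Basic
import HarnessLib

/-!
# Dedekind coefficients of a norm-non-increasing endomorphism of a tame Galois `p`-adic field: the ISOMETRIES are the units of the
# integral Galois order `𝒪_K⟨Gal(K/ℚ_p)⟩`

abc-iut cell, seat abc-iut-E-t42 (gen 4; rung LADDER-ABC:A2.RESCUE.J, R-J row Y-29b «dividing line of the isometric (Ind2)»).  PROOF-ONLY
classical local algebra (Serre, *Local Fields* III §3; Neukirch II (4.8)); no definition, no `Prop` fact, no `sorry`.  It supplies, at TAME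
places, the hypothesis shape `hIsmG` («`g′` and `g′⁻¹` are finite sums `Σ_τ c_τ·τ`, `τ ∈ Aut_{ℚ_p-alg}(K)`, `‖c_τ‖ ≤ 1`») of the cell's
`Summit.ABC.IUTFork.Joshi.PinsGaloisOrder.exists_pinnedRegions_honestSetting_of_galoisOrderIsm` (p460152) for ALL isometries.

* `apply_eq_sum_dedekindCoeff_mul` — `K/ℚ_p` finite Galois, `(b, d)` a trace-dual pair of `ℚ_p`-bases (`Tr(d_i b_j) = δ_{ij}`, campaign-S
  `exists_traceDual_basis`): every `ℚ_p`-linear `f` is `Σ_σ a_σ·σ` with `a_σ = Σ_m f(b_m)·σ(d_m)` (Mathlib `trace_eq_sum_automorphisms` +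
  the dual expansion `x = Σ_m Tr(x d_m)·b_m` of `PacketDifferentSharp`);
* `norm_dedekindCoeff_le_one` — if the pair is NORM-UNIMODULAR (`‖b_m‖·‖d_m‖ ≤ 1`) and `‖f x‖ ≤ ‖x‖`, then `‖a_σ‖ ≤ 1`;
* `exists_galoisOrder_repr_of_norm_le`, **`exists_galoisOrder_repr_of_isometry`** — hence norm-non-increasing maps lie in `𝒪_K⟨Gal⟩` and
  isometries, with their inverses, are UNITS of it (the `hIsmG` shape, verbatim);
* `not_forall_norm_trace_lt_one_of_dualPair` — a norm-unimodular dual pair gives `x = b_m d_m ∈ 𝒪_K` with `Tr x = 1`, so this file's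
  hypothesis EXCLUDES the wild hypothesis `∀ x, ‖x‖ ≤ 1 → ‖Tr x‖ < 1` of the cell's negative half (p457646,
  `PinsIsometricShear.not_pinnedRegions_honestSetting_of_isometries_of_wild`): the two kernel halves of the dividing line never meet.

HONEST SCOPE.  A norm-unimodular dual pair exists exactly when `K/ℚ_p` is TAMELY ramified (`b = ω_r π^j`, `d = ω_r^∨ π^{−j}/e` for an
unramified integral basis `ω`, a uniformizer `π`, `e` a unit; conversely `Tr(𝒪_K) = ℤ_p`); that existence statement is NOT proved here —
the pair is a hypothesis, explicit in examples (`K = ℚ_p(π)`, `π² = p`, `p` odd: `b = (1, π)`, `d = (1/2, 1/(2π))`).  Nothing here is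
disputed mathematics; the consumer rows are the cell's typings [claim: Mochizuki2012, status: disputed] of (Ind2).
[cite: SerreLocalFields1979, Ch. III §3] [cite: NeukirchANT1999, Ch. II (4.8)]
-/

noncomputable section

open Module

namespace Literature.IUT.LogVolume

section Dedekind

variable {p : ℕ} [Fact p.Prime] {K : Type} [NontriviallyNormedField K] [NormedAlgebra ℚ_[p] K]
  [FiniteDimensional ℚ_[p] K] [IsGalois ℚ_[p] K]
variable {κ : Type} [Fintype κ] [DecidableEq κ] (b d : Basis κ ℚ_[p] K)
  (hbd : ∀ i j, Algebra.trace ℚ_[p] K (d i * b j) = if j = i then 1 else 0)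
include hbd

/-- **Dedekind expansion with explicit coefficients.**  For `K/ℚ_p` finite Galois and a trace-dual pair of `ℚ_p`-bases `(b, d)`
(`Tr(d_i b_j) = δ_{ij}`), EVERY `ℚ_p`-linear `f : K → K` is `f = Σ_{σ ∈ Gal} a_σ·σ` with `a_σ = Σ_m f(b_m)·σ(d_m)`:
expand `x = Σ_m Tr(x d_m)·b_m` and use `Tr(y) = Σ_σ σ(y)` (Mathlib `trace_eq_sum_automorphisms`).
[cite: SerreLocalFields1979, Ch. III §3] [cite: NeukirchANT1999, Ch. II (4.8)] -/
theorem apply_eq_sum_dedekindCoeff_mul (f : K →ₗ[ℚ_[p]] K) (x : K) :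
    f x = ∑ σ : K ≃ₐ[ℚ_[p]] K, (∑ m, f (b m) * σ (d m)) * σ x := by
  calc f x = f (∑ m, Algebra.trace ℚ_[p] K (x * d m) • b m) := by rw [dualPair_sum_trace_mul_smul' b d hbd x]
    _ = ∑ m, f (b m) * algebraMap ℚ_[p] K (Algebra.trace ℚ_[p] K (x * d m)) := by
        rw [map_sum]
        exact Finset.sum_congr rfl fun m _ => by rw [map_smul, Algebra.smul_def, mul_comm]
    _ = ∑ m, f (b m) * ∑ σ : K ≃ₐ[ℚ_[p]] K, σ (x * d m) := by simp_rw [trace_eq_sum_automorphisms]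
    _ = ∑ σ : K ≃ₐ[ℚ_[p]] K, (∑ m, f (b m) * σ (d m)) * σ x := by
        simp_rw [Finset.mul_sum, Finset.sum_mul]
        rw [Finset.sum_comm]
        exact Finset.sum_congr rfl fun σ _ => Finset.sum_congr rfl fun m _ => by rw [map_mul]; ring

omit [FiniteDimensional ℚ_[p] K] [IsGalois ℚ_[p] K] [DecidableEq κ] hbd in
/-- **Integrality of the Dedekind coefficients at a NORM-UNIMODULAR dual pair.**  If `‖b_m‖·‖d_m‖ ≤ 1` for all `m` and `f` does not
increase norms, then `‖Σ_m f(b_m)·σ(d_m)‖ ≤ 1` for every `ℚ_p`-algebra automorphism `σ` (ultrametric inequality; `σ` is an isometry —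
campaign-S `norm_map_algHom`; `K` locally compact). [cite: NeukirchANT1999, Ch. II (4.8)] -/
theorem norm_dedekindCoeff_le_one [IsUltrametricDist K] [ProperSpace K] (hnorm : ∀ m, ‖b m‖ * ‖d m‖ ≤ 1)
    (f : K →ₗ[ℚ_[p]] K) (hf : ∀ x, ‖f x‖ ≤ ‖x‖) (σ : K ≃ₐ[ℚ_[p]] K) : ‖∑ m, f (b m) * σ (d m)‖ ≤ 1 := by
  refine IsUltrametricDist.norm_sum_le_of_forall_le_of_nonneg zero_le_one fun m _ => ?_
  have hσ : ‖σ (d m)‖ = ‖d m‖ := norm_map_algHom (σ : K →ₐ[ℚ_[p]] K) (d m)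
  rw [norm_mul, hσ]
  exact (mul_le_mul_of_nonneg_right (hf (b m)) (norm_nonneg _)).trans (hnorm m)

/-- **At a Galois `K` with a norm-unimodular trace-dual pair, every norm-non-increasing `ℚ_p`-linear endomorphism lies in the INTEGRAL
GALOIS ORDER `𝒪_K⟨Gal(K/ℚ_p)⟩`**: `f = Σ_{σ} c_σ·σ` with `‖c_σ‖ ≤ 1` (the shape consumed by abc-iut-E-t42's
`Summit.ABC.IUTFork.Joshi.PinsGaloisOrder`, p460152).  Such a pair exists exactly when `K/ℚ_p` is TAMELY ramified (`b = ω_r π^j`,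
`d = ω_r^∨ π^{−j}/e` for an unramified integral basis `ω` and a uniformizer `π`; conversely `Tr(b_m d_m) = 1` with `b_m d_m ∈ 𝒪_K` forces
`Tr(𝒪_K) = ℤ_p`) — the existence statement is not proved here. [cite: SerreLocalFields1979, Ch. III §3] [cite: NeukirchANT1999, Ch. II (4.8)] -/
theorem exists_galoisOrder_repr_of_norm_le [IsUltrametricDist K] [ProperSpace K] (hnorm : ∀ m, ‖b m‖ * ‖d m‖ ≤ 1)
    (f : K →ₗ[ℚ_[p]] K) (hf : ∀ x, ‖f x‖ ≤ ‖x‖) :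
    ∃ (T : Finset (K ≃ₐ[ℚ_[p]] K)) (c : (K ≃ₐ[ℚ_[p]] K) → K), (∀ τ ∈ T, ‖c τ‖ ≤ 1) ∧ ∀ x, f x = ∑ τ ∈ T, c τ * τ x :=
  ⟨Finset.univ, fun σ => ∑ m, f (b m) * σ (d m), fun σ _ => norm_dedekindCoeff_le_one b d hnorm f hf σ,
    fun x => apply_eq_sum_dedekindCoeff_mul b d hbd f x⟩

/-- **Isometries of a tame Galois `K` are units of the integral Galois order**: for a `ℚ_p`-linear ISOMETRY `g` of `K` (Galois, with a
norm-unimodular trace-dual pair), both `g` and `g⁻¹` are sums `Σ_σ c_σ·σ` with `‖c_σ‖ ≤ 1` — literally the hypothesis `hIsmG` of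
abc-iut-E-t42's `PinsGaloisOrder.exists_pinnedRegions_honestSetting_of_galoisOrderIsm` (p460152) at this field.
[cite: SerreLocalFields1979, Ch. III §3] [cite: NeukirchANT1999, Ch. II (4.8)] -/
theorem exists_galoisOrder_repr_of_isometry [IsUltrametricDist K] [ProperSpace K] (hnorm : ∀ m, ‖b m‖ * ‖d m‖ ≤ 1)
    (g : K ≃ₗ[ℚ_[p]] K) (hg : ∀ x, ‖g x‖ = ‖x‖) :
    (∃ (T : Finset (K ≃ₐ[ℚ_[p]] K)) (c : (K ≃ₐ[ℚ_[p]] K) → K), (∀ τ ∈ T, ‖c τ‖ ≤ 1) ∧ ∀ x, g x = ∑ τ ∈ T, c τ * τ x) ∧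
    (∃ (T : Finset (K ≃ₐ[ℚ_[p]] K)) (c : (K ≃ₐ[ℚ_[p]] K) → K), (∀ τ ∈ T, ‖c τ‖ ≤ 1) ∧ ∀ x, g.symm x = ∑ τ ∈ T, c τ * τ x) :=
  ⟨exists_galoisOrder_repr_of_norm_le b d hbd hnorm g (fun x => (hg x).le),
    exists_galoisOrder_repr_of_norm_le b d hbd hnorm g.symm fun x => by
      conv_rhs => rw [← g.apply_symm_apply x]
      rw [hg]
      exact le_rfl⟩

omit [FiniteDimensional ℚ_[p] K] [IsGalois ℚ_[p] K] [Fintype κ] in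
/-- **A norm-unimodular dual pair forces a unit trace on the integers** (`x := b_m·d_m ∈ 𝒪_K` has `Tr x = 1`): the hypothesis of this
file is incompatible with the WILD hypothesis `∀ x, ‖x‖ ≤ 1 → ‖Tr x‖ < 1` of abc-iut-E-t42's negative half
`Summit.ABC.IUTFork.Joshi.PinsIsometricShear.not_pinnedRegions_honestSetting_of_isometries_of_wild` (p457646) — the two kernel halves of the
dividing line never apply to the same field. [cite: SerreLocalFields1979, Ch. III §3, Prop. 7] -/
theorem not_forall_norm_trace_lt_one_of_dualPair [Nonempty κ] (hnorm : ∀ m, ‖b m‖ * ‖d m‖ ≤ 1) :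
    ¬ ∀ x : K, ‖x‖ ≤ 1 → ‖Algebra.trace ℚ_[p] K x‖ < 1 := by
  obtain ⟨m⟩ := ‹Nonempty κ›
  intro h
  have h1 := h (d m * b m) (by rw [norm_mul, mul_comm]; exact hnorm m)
  rw [hbd m m, if_pos rfl, norm_one] at h1
  exact lt_irrefl _ h1

end Dedekind

end Literature.IUT.LogVolume

end
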